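import Literature.NumberTheory.GaloisRepresentations.SemiLocalInflation
import Literature.NumberTheory.GaloisRepresentations.SemiLocalShapiroConjugation
import HarnessLib

/-!
# The semi-local Shapiro isomorphism and inflation in a tower `F ⊆ E ⊆ E'`:
# `Sh_{w'} ∘ Hⁿ(res, ι_v) = Inf_{E_w ⊆ E'_{w'}} ∘ Sh_{w'∩E}` (Tate, C–F VII §7.2; Serre, *Local Fields* XI §3)

Topic `NumberTheory/GaloisRepresentations`; namespace `Literature.NumberTheory.GaloisRepresentations.SemiLocal`, continuing
`SemiLocalInflation.lean` (`Place.below w'`, `inflRepHom : Res_{res}(∏_{w∣v} E_wˣ) ⟶ ∏_{w'∣v} E'_{w'}ˣ`, `semiLocalInf v n`)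
and `SemiLocalShapiroConjugation.lean` (`groupCohomologyUnitsRepIso_hom_eq`: the Shapiro isomorphism is restriction to `G_w`
followed by the `w`-projection; the generic `map_congr'` calculus).  Definitions with bodies (`stabilizerRestrict`,
`localRestrict`, `localInclHom`, `localInf`) and theorems; NO named fact, no `sorry`, no instance, no notation; number fields
in `Type`.

Mathematics.  Let `w' ∣ v` be a place of `E'` and `w = w' ∩ E`.  The decomposition group `G'_{w'} ≤ Gal(E'/F)` restricts
into `G_w ≤ Gal(E/F)` (`(g'|_E) w = (g' w') ∩ E = w`), hence, through the identifications `G_w ≃ Gal(E_w/F_v)`,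
`G'_{w'} ≃ Gal(E'_{w'}/F_v)` of the tree, a restriction `Gal(E'_{w'}/F_v) → Gal(E_w/F_v)` (§1, `localRestrict`); with the
inclusion `E_w ⊆ E'_{w'}` (`adicCompletionOfUnder`) this is a morphism of pairs and induces the LOCAL INFLATION
`Inf : Hⁿ(Gal(E_w/F_v), E_wˣ) → Hⁿ(Gal(E'_{w'}/F_v), E'_{w'}ˣ)` (§2, `localInf`).  §3 proves that the semi-local Shapiro
isomorphisms intertwine the semi-local inflation `Hⁿ(res, ι_v)` with the local one:
**`Sh_{w'} ∘ Hⁿ(res, ι_v) = Inf ∘ Sh_w`** — both composites are `Hⁿ` of ONE morphism of pairs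
`(Gal(E'_{w'}/F_v), E'_{w'}ˣ) → (Gal(E/F), ∏_{w∣v} E_wˣ)` (`ψ' ↦ (g'|_E)` where `g'_{w'} = ψ'`, `u ↦ u_w ∈ E_w ⊆ E'_{w'}`),
so the statement is `groupCohomology.map_comp` + `map_congr'`.  This is the semi-local half of the compatibility of the
idèle invariants with inflation (Tate VII §7.2: the local invariants are computed in any `w ∣ v`; Serre XI §3: `Inf` on the
layers of the local class formation); the local half (`inv_{E'_{w'}/F_v} ∘ Inf = inv_{E_w/F_v}`) is the local files' business.

## What is formalised

* §1 `stabilizerRestrict w' : G'_{w'} →* G_{w'∩E}`, `coe_stabilizerRestrict_apply`, `localRestrict w' :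
  Gal(E'_{w'}/F_v) →* Gal(E_w/F_v)`, `localRestrict_decompAlgEquiv`.
* §2 `localInclHom w'` (`E_wˣ ⊆ E'_{w'}ˣ` over `localRestrict`), `coe_toMul_localInclHom`, `localInf w' n`.
* §3 **`groupCohomologyUnitsRepIsoAut_hom_comp_localInf`** and its element form
  `groupCohomologyUnitsRepIsoAut_semiLocalInf`: `Sh_{w'} (Hⁿ(res, ι_v) x) = localInf w' n (Sh_{w'∩E} x)`.

## References
* J. W. S. Cassels, A. Fröhlich (eds.), *Algebraic Number Theory* (1967), Ch. VII (Tate) §1.1, §7.2. [CasselsFrohlichANT1967]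
* J.-P. Serre, *Local Fields*, GTM 67 (1979), Ch. XI §3; Ch. VII §5–§6 (`Inf`, `Res` as maps of pairs). [SerreLocalFields1979]
-/

noncomputable section

open NumberField IsDedekindDomain CategoryTheory groupCohomology
open Literature.NumberTheory.Automorphic

namespace Literature.NumberTheory.GaloisRepresentations

namespace SemiLocal

open Literature.Algebra.Homology

variable {F E E' : Type} [Field F] [NumberField F] [Field E] [NumberField E] [Field E'] [NumberField E']
  [Algebra F E] [Algebra E E'] [Algebra F E'] [IsScalarTower F E E'] [Normal F E]
variable {v : HeightOneSpectrum (𝓞 F)}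

/-! ## §1. Restriction of decomposition groups: `G'_{w'} → G_{w'∩E}` and `Gal(E'_{w'}/F_v) → Gal(E_w/F_v)` -/

/-- **`G'_{w'} →* G_{w'∩E}`, `g' ↦ g'|_E`** (`(g'|_E)(w' ∩ E) = (g'w') ∩ E = w' ∩ E`).
[cite: CasselsFrohlichANT1967, Ch. VII §1.1] -/
def stabilizerRestrict (w' : Place F E' v) :
    MulAction.stabilizer (E' ≃ₐ[F] E') w' →* MulAction.stabilizer (E ≃ₐ[F] E) (Place.below w' : Place F E v) :=
  ((AlgEquiv.restrictNormalHom (F := F) (K₁ := E') E).comp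
    (MulAction.stabilizer (E' ≃ₐ[F] E') w').subtype).codRestrict _ fun g' => by
    rw [MulAction.mem_stabilizer_iff]
    change (g' : E' ≃ₐ[F] E').restrictNormal E • (Place.below w' : Place F E v) = Place.below w'
    rw [← Place.below_smul, MulAction.mem_stabilizer_iff.mp g'.2]

/-- Unfolding `stabilizerRestrict`. [cite: CasselsFrohlichANT1967, Ch. VII §1.1] -/
@[simp] theorem coe_stabilizerRestrict_apply (w' : Place F E' v) (g' : MulAction.stabilizer (E' ≃ₐ[F] E') w') :
    ((stabilizerRestrict w' g' : MulAction.stabilizer (E ≃ₐ[F] E) (Place.below w' : Place F E v)) : E ≃ₐ[F] E) =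
      (g' : E' ≃ₐ[F] E').restrictNormal E := rfl

variable [IsGalois F E] [IsGalois F E']

/-- **The restriction `Gal(E'_{w'}/F_v) →* Gal(E_w/F_v)`** (`w = w' ∩ E`), through the tree's identifications
`decompMulEquiv : G_w ≃* Gal(E_w/F_v)`. [cite: CasselsFrohlichANT1967, Ch. VII §1.1] -/
def localRestrict (w' : Place F E' v) :
    ((w' : HeightOneSpectrum (𝓞 E')).adicCompletion E' ≃ₐ[v.adicCompletion F] (w' : HeightOneSpectrum (𝓞 E')).adicCompletion E') →*
      (((Place.below w' : Place F E v) : HeightOneSpectrum (𝓞 E)).adicCompletion E ≃ₐ[v.adicCompletion F]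
        ((Place.below w' : Place F E v) : HeightOneSpectrum (𝓞 E)).adicCompletion E) :=
  (decompMulEquiv (Place.below w' : Place F E v)).toMonoidHom.comp
    ((stabilizerRestrict w').comp (decompMulEquiv w').symm.toMonoidHom)

/-- `localRestrict` on `g'_{w'}` is `(g'|_E)_w`. [cite: CasselsFrohlichANT1967, Ch. VII §1.1] -/
theorem localRestrict_decompAlgEquiv (w' : Place F E' v) (g' : MulAction.stabilizer (E' ≃ₐ[F] E') w') :
    localRestrict w' (decompAlgEquiv w' g') = decompAlgEquiv (Place.below w' : Place F E v) (stabilizerRestrict w' g') := by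
  change decompMulEquiv (Place.below w' : Place F E v)
    (stabilizerRestrict w' ((decompMulEquiv w').symm (decompMulEquiv w' g'))) = _
  rw [MulEquiv.symm_apply_apply, decompMulEquiv_apply]

/-! ## §2. `E_wˣ ⊆ E'_{w'}ˣ` over `localRestrict` and the local inflation -/

omit [IsGalois F E] [IsGalois F E'] in
/-- `(g'|_E)_w` and `g'_{w'}` are compatible with `E_w ⊆ E'_{w'}`. [cite: CasselsFrohlichANT1967, Ch. VII §1.1] -/
theorem decompAlgEquiv_adicCompletionOfUnder (w' : Place F E' v) (g' : MulAction.stabilizer (E' ≃ₐ[F] E') w')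
    (y : ((Place.below w' : Place F E v) : HeightOneSpectrum (𝓞 E)).adicCompletion E) :
    decompAlgEquiv w' g' (adicCompletionOfUnder (𝓞 E) E E' (w' : HeightOneSpectrum (𝓞 E')) y) =
      adicCompletionOfUnder (𝓞 E) E E' (w' : HeightOneSpectrum (𝓞 E'))
        (decompAlgEquiv (Place.below w' : Place F E v) (stabilizerRestrict w' g') y) := by
  rw [decompAlgEquiv_apply, decompAlgEquiv_apply]
  exact galAdicCompletionMap_adicCompletionOfUnder (g' : E' ≃ₐ[F] E') (coe_stabilizer_smul w' g')
    (coe_stabilizer_smul (Place.below w' : Place F E v) (stabilizerRestrict w' g')) y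

/-- **`E_wˣ → E'_{w'}ˣ` as a morphism `Res_{localRestrict}(E_wˣ) ⟶ E'_{w'}ˣ` of `Gal(E'_{w'}/F_v)`-modules.**
[cite: SerreLocalFields1979, Ch. XI §3] -/
def localInclHom (w' : Place F E' v) :
    Rep.res (localRestrict w') (Rep.ofAlgebraAutOnUnits (v.adicCompletion F)
        (((Place.below w' : Place F E v) : HeightOneSpectrum (𝓞 E)).adicCompletion E)) ⟶
      Rep.ofAlgebraAutOnUnits (v.adicCompletion F) ((w' : HeightOneSpectrum (𝓞 E')).adicCompletion E') :=
  Rep.ofHom (LinearMap.intertwiningMap_of_isIntertwiningMap _ _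
    (MonoidHom.toAdditive (Units.map
      (adicCompletionOfUnder (𝓞 E) E E' (w' : HeightOneSpectrum (𝓞 E'))).toMonoidHom)).toIntLinearMap fun ψ' x => by
      obtain ⟨g', rfl⟩ := (decompMulEquiv w').surjective ψ'
      apply (Additive.toMul (α := ((w' : HeightOneSpectrum (𝓞 E')).adicCompletion E')ˣ)).injective
      refine Units.ext ?_
      change adicCompletionOfUnder (𝓞 E) E E' (w' : HeightOneSpectrum (𝓞 E'))
          (localRestrict w' (decompMulEquiv w' g')
            (((Additive.toMul x : (((Place.below w' : Place F E v) : HeightOneSpectrum (𝓞 E)).adicCompletion E)ˣ) :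
              ((Place.below w' : Place F E v) : HeightOneSpectrum (𝓞 E)).adicCompletion E))) =
        decompMulEquiv w' g' (adicCompletionOfUnder (𝓞 E) E E' (w' : HeightOneSpectrum (𝓞 E'))
          (((Additive.toMul x : (((Place.below w' : Place F E v) : HeightOneSpectrum (𝓞 E)).adicCompletion E)ˣ) :
              ((Place.below w' : Place F E v) : HeightOneSpectrum (𝓞 E)).adicCompletion E)))
      rw [decompMulEquiv_apply, localRestrict_decompAlgEquiv, decompAlgEquiv_adicCompletionOfUnder])

/-- Unfolding `localInclHom` on values: it is `E_w ⊆ E'_{w'}`. [cite: SerreLocalFields1979, Ch. XI §3] -/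
theorem coe_toMul_localInclHom (w' : Place F E' v)
    (x : Additive (((Place.below w' : Place F E v) : HeightOneSpectrum (𝓞 E)).adicCompletion E)ˣ) :
    ((Additive.toMul ((localInclHom w').hom x) : ((w' : HeightOneSpectrum (𝓞 E')).adicCompletion E')ˣ) :
        (w' : HeightOneSpectrum (𝓞 E')).adicCompletion E') =
      adicCompletionOfUnder (𝓞 E) E E' (w' : HeightOneSpectrum (𝓞 E'))
        ((Additive.toMul x : (((Place.below w' : Place F E v) : HeightOneSpectrum (𝓞 E)).adicCompletion E)ˣ) :
          ((Place.below w' : Place F E v) : HeightOneSpectrum (𝓞 E)).adicCompletion E) := rfl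

/-- **The local inflation `Inf : Hⁿ(Gal(E_w/F_v), E_wˣ) → Hⁿ(Gal(E'_{w'}/F_v), E'_{w'}ˣ)`** (`w = w' ∩ E`), Mathlib's
`groupCohomology.map` of the pair `(localRestrict, E_wˣ ⊆ E'_{w'}ˣ)`. [cite: SerreLocalFields1979, Ch. XI §3] -/
def localInf (w' : Place F E' v) (n : ℕ) :
    groupCohomology (Rep.ofAlgebraAutOnUnits (v.adicCompletion F)
        (((Place.below w' : Place F E v) : HeightOneSpectrum (𝓞 E)).adicCompletion E)) n ⟶
      groupCohomology (Rep.ofAlgebraAutOnUnits (v.adicCompletion F) ((w' : HeightOneSpectrum (𝓞 E')).adicCompletion E')) n :=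
  groupCohomology.map (localRestrict w') (localInclHom w') n

/-! ## §3. `Sh_{w'} ∘ Hⁿ(res, ι_v) = Inf ∘ Sh_{w'∩E}` -/

/-- **The semi-local Shapiro isomorphisms intertwine the semi-local and the local inflation**:
`Sh_{w'∩E} ≫ localInf w' = semiLocalInf v ≫ Sh_{w'}` as maps `Hⁿ(Gal(E/F), ∏_{w∣v} E_wˣ) → Hⁿ(Gal(E'_{w'}/F_v), E'_{w'}ˣ)`
(both are `Hⁿ` of the morphism of pairs `ψ' = g'_{w'} ↦ g'|_E`, `u ↦ u_{w'∩E}`).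
[cite: CasselsFrohlichANT1967, Ch. VII §7.2][cite: SerreLocalFields1979, Ch. XI §3] -/
theorem groupCohomologyUnitsRepIsoAut_hom_comp_localInf (w' : Place F E' v) (n : ℕ) :
    (groupCohomologyUnitsRepIsoAut (Place.below w' : Place F E v) n).hom ≫ localInf w' n =
      IdeleCohomology.semiLocalInf E E' v n ≫ (groupCohomologyUnitsRepIsoAut w' n).hom := by
  rw [groupCohomologyUnitsRepIsoAut, groupCohomologyUnitsRepIsoAut, Iso.trans_hom, Iso.trans_hom,
    groupCohomologyUnitsRepIso_hom_eq, groupCohomologyUnitsRepIso_hom_eq, groupCohomologyLocalUnitsRepIso,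
    groupCohomologyLocalUnitsRepIso, groupCohomology.mapIso_hom, groupCohomology.mapIso_hom, localInf,
    IdeleCohomology.semiLocalInf, ← groupCohomology.map_comp, ← groupCohomology.map_comp, ← groupCohomology.map_comp,
    ← groupCohomology.map_comp]
  refine map_congr' ?_ _ _ (fun a => ?_) n
  · refine MonoidHom.ext fun ψ' => ?_
    obtain ⟨g', rfl⟩ := (decompMulEquiv w').surjective ψ'
    change (((decompMulEquiv (Place.below w' : Place F E v)).symm (localRestrict w' (decompMulEquiv w' g')) :
        MulAction.stabilizer (E ≃ₐ[F] E) (Place.below w' : Place F E v)) : E ≃ₐ[F] E) =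
      AlgEquiv.restrictNormalHom E (((decompMulEquiv w').symm (decompMulEquiv w' g') :
        MulAction.stabilizer (E' ≃ₐ[F] E') w') : E' ≃ₐ[F] E')
    rw [MulEquiv.symm_apply_apply, show localRestrict w' (decompMulEquiv w' g') =
      decompMulEquiv (Place.below w' : Place F E v)
        (stabilizerRestrict w' ((decompMulEquiv w').symm (decompMulEquiv w' g'))) from rfl,
      MulEquiv.symm_apply_apply, MulEquiv.symm_apply_apply]
    rfl
  · apply (Additive.toMul (α := ((w' : HeightOneSpectrum (𝓞 E')).adicCompletion E')ˣ)).injective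
    exact Units.ext rfl

/-- Element form: **`Sh_{w'} (Hⁿ(res, ι_v) x) = localInf w' n (Sh_{w'∩E} x)`**.
[cite: CasselsFrohlichANT1967, Ch. VII §7.2] -/
theorem groupCohomologyUnitsRepIsoAut_semiLocalInf (w' : Place F E' v) (n : ℕ) (x : groupCohomology (unitsRep F E v) n) :
    (groupCohomologyUnitsRepIsoAut w' n).hom (IdeleCohomology.semiLocalInf E E' v n x) =
      localInf w' n ((groupCohomologyUnitsRepIsoAut (Place.below w' : Place F E v) n).hom x) :=
  (congrArg (fun φ => φ x) (groupCohomologyUnitsRepIsoAut_hom_comp_localInf (F := F) (E := E) (E' := E') w' n)).symm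

end SemiLocal

end Literature.NumberTheory.GaloisRepresentations

end
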